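import Literature.NumberTheory.GaloisRepresentations.PadicIntermediateFieldIntegers
import Literature.AlgebraicGeometry.Resolution.AdicNoetherian
import Literature.AlgebraicGeometry.Resolution.AdicCompletionRegular
import Literature.AlgebraicGeometry.Resolution.AdicCompletionSemilocal
import Mathlib.RingTheory.AdicCompletion.LocalRing
import Mathlib.RingTheory.AdicCompletion.RingHom
import Mathlib.RingTheory.RegularLocalRing.Polynomial
import HarnessLib

/-!
# The universal unramified framed deformation ring `𝒪_L⟦X_{ij}⟧` as a complete regular local ring

Let `L/ℚ_p` be finite inside `ℚ̄_p`, `𝒪 = 𝒪_L` its integers (a complete discrete valuation ring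
with finite residue field `k = k_L`, `PadicIntermediateFieldIntegers`) and `n : ℕ`.  The ring
`R⁰ = 𝒪⟦X_{ij} : i, j ∈ Fin n⟧` — realised as the adic completion of the polynomial ring
`S = 𝒪[X_{ij}]` at the maximal ideal `𝔪₀ = (λ, X_{ij}) = ker (S → k)` (Mathlib
`AdicCompletion`) — is the universal framed deformation ring of ANY unramified
`ρ̄ : Γ_K → GL_n(k)` with the universal Frobenius `ĝ₀ + (X_{ij})` (files `UnramifiedFrameLift`,
`UnramifiedCrystallineDeformationRing`).  This file records its commutative algebra, all PROVED:

* `frameRing L n` : complete Noetherian local `𝒪`-algebra (`Stacks0316`,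
  `AdicCompletion.isAdicComplete_self`, `isLocalRing_of_isAdicComplete_maximal`), maximal ideal
  `𝔪₀ R⁰` (`maximalIdeal_frameRing`), residue map `frameResidue : R⁰ →ₐ[𝒪] k`
  (Mathlib `AdicCompletion.kerProj`) surjective with kernel `𝔪` and finite residue field;
* `frameRing` is a regular local ring, hence a domain (tree:
  `isRegularLocalRing_adicCompletion` applied to `S_{𝔪₀}` via `adicCompletionAtMaximalEquiv`;
  Serre/Auslander–Buchsbaum `isDomain_of_isRegularLocalRing`), `S → R⁰` is injective
  (Krull), and `p ≠ 0` in `R⁰`;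
* the frame variables `frameVar ij ∈ 𝔪` and the density of polynomials:
  `exists_polynomial_sub_mem_pow`.

No named facts, no `sorry`.

## References

* B. Mazur, *An introduction to the deformation theory of Galois representations* (1997), §§8–10.
* M. Kisin, *Potentially semi-stable deformation rings*, JAMS 21 (2008), (3.3.3). [Kisin2007]
* [BLGGT] T. Barnet-Lamb, T. Gee, D. Geraghty, R. Taylor, Ann. of Math. 179 (2014), §1.2–1.4.
  [BarnetlambEtAl2014]
-/

noncomputable section

open IsLocalRing

namespace Literature.NumberTheory.GaloisRepresentations

variable {p : ℕ} [Fact p.Prime] (L : IntermediateField ℚ_[p] (PadicAlgCl p)) (n : ℕ)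

/-! ### The polynomial ring in the frame variables and its augmentation -/

/-- `S = 𝒪_L[X_{ij} : i, j ∈ Fin n]`. [folklore] -/
abbrev framePoly : Type :=
  MvPolynomial (Fin n × Fin n) (intermediateFieldIntegers p L)

/-- The augmentation `S → k_L`, `X_{ij} ↦ 0`, `𝒪_L → k_L` the residue map. [folklore] -/
def frameAug : framePoly L n →ₐ[intermediateFieldIntegers p L] ResidueField (intermediateFieldIntegers p L) :=
  MvPolynomial.aeval fun _ => 0

/-- The augmentation is surjective. [folklore] -/
theorem frameAug_surjective : Function.Surjective (frameAug L n) := fun y => by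
  obtain ⟨a, rfl⟩ := residue_surjective y
  exact ⟨MvPolynomial.C a, by simp [frameAug]⟩

/-- `𝔪₀ = ker (S → k_L) = (λ, X_{ij})`. [folklore] -/
abbrev frameIdeal : Ideal (framePoly L n) :=
  RingHom.ker (frameAug L n)

/-- `𝔪₀` is a maximal ideal. [folklore] -/
instance frameIdeal_isMaximal : (frameIdeal L n).IsMaximal :=
  RingHom.ker_isMaximal_of_surjective _ (frameAug_surjective L n)

variable [FiniteDimensional ℚ_[p] L]

/-- `𝔪₀` is finitely generated. [folklore] -/
theorem frameIdeal_fg : (frameIdeal L n).FG :=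
  IsNoetherian.noetherian _

/-! ### The completed ring -/

/-- **`R⁰ = 𝒪_L⟦X_{ij}⟧`**, the `𝔪₀`-adic completion of `S = 𝒪_L[X_{ij}]` — the universal
unramified framed deformation ring of rank `n` over `𝒪_L` (Mazur §10; Kisin (3.3.3) with the
unramified condition). [cite: Kisin2007, (3.3.3)] -/
abbrev frameRing : Type :=
  AdicCompletion (frameIdeal L n) (framePoly L n)

/-- `R⁰` is Noetherian (Stacks 0316). [cite: StacksProject, Tag 0316] -/
instance frameRing_isNoetherianRing : IsNoetherianRing (frameRing L n) :=
  Literature.AlgebraicGeometry.Resolution.Stacks0316 _ _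

/-- `𝔪₀ R⁰` is a maximal ideal. [folklore] -/
instance frameRing_isMaximal_map :
    ((frameIdeal L n).map (algebraMap (framePoly L n) (frameRing L n))).IsMaximal :=
  AdicCompletion.isMaximal_map_of_le _ _ le_rfl (frameIdeal_fg L n)

/-- `R⁰` is `𝔪₀ R⁰`-adically complete. [cite: StacksProject, Tag 05GH] -/
instance frameRing_isAdicComplete_map :
    IsAdicComplete ((frameIdeal L n).map (algebraMap (framePoly L n) (frameRing L n))) (frameRing L n) :=
  AdicCompletion.isAdicComplete_self _ (frameIdeal_fg L n)

/-- `R⁰` is a local ring. [folklore] -/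
instance frameRing_isLocalRing : IsLocalRing (frameRing L n) :=
  isLocalRing_of_isAdicComplete_maximal ((frameIdeal L n).map (algebraMap (framePoly L n) (frameRing L n)))

/-- **The maximal ideal of `R⁰` is `𝔪₀ R⁰`.** [folklore] -/
theorem maximalIdeal_frameRing :
    maximalIdeal (frameRing L n) = (frameIdeal L n).map (algebraMap (framePoly L n) (frameRing L n)) :=
  (IsLocalRing.eq_maximalIdeal inferInstance).symm

/-- `R⁰` is complete for its maximal ideal. [folklore] -/
instance frameRing_isAdicComplete : IsAdicComplete (maximalIdeal (frameRing L n)) (frameRing L n) := by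
  rw [maximalIdeal_frameRing]
  infer_instance

/-! ### The residue map -/

/-- **The residue map `R⁰ → k_L`** (an `𝒪_L`-algebra homomorphism). [folklore] -/
def frameResidue : frameRing L n →ₐ[intermediateFieldIntegers p L] ResidueField (intermediateFieldIntegers p L) :=
  AdicCompletion.kerProj (frameAug_surjective L n)

omit [FiniteDimensional ℚ_[p] L] in
/-- The residue map is surjective. [folklore] -/
theorem frameResidue_surjective : Function.Surjective (frameResidue L n) :=
  AdicCompletion.kerProj_surjective _

omit [FiniteDimensional ℚ_[p] L] in
/-- The residue map on polynomials is the augmentation. [folklore] -/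
@[simp] theorem frameResidue_algebraMap (s : framePoly L n) :
    frameResidue L n (algebraMap (framePoly L n) (frameRing L n) s) = frameAug L n s := by
  rw [AdicCompletion.algebraMap_apply, Algebra.algebraMap_self, RingHom.id_apply]
  exact AdicCompletion.kerProj_of _ s

omit [FiniteDimensional ℚ_[p] L] in
/-- The residue map vanishes exactly where `evalOneₐ` does. [folklore] -/
theorem frameResidue_eq_zero_iff (x : frameRing L n) :
    frameResidue L n x = 0 ↔ AdicCompletion.evalOneₐ (frameIdeal L n) x = 0 := by
  simp only [frameResidue, AdicCompletion.kerProj, AlgHom.coe_comp, Function.comp_apply,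
    AlgHom.coe_restrictScalars', AlgEquiv.coe_toAlgHom, EmbeddingLike.map_eq_zero_iff]

/-- **The kernel of the residue map is the maximal ideal.** [folklore] -/
theorem ker_frameResidue : RingHom.ker (frameResidue L n) = maximalIdeal (frameRing L n) := by
  rw [maximalIdeal_frameRing, ← AdicCompletion.ker_evalOneₐ_eq_map _ (frameIdeal_fg L n)]
  ext x
  rw [RingHom.mem_ker, RingHom.mem_ker, frameResidue_eq_zero_iff]
  exact Iff.rfl

/-- Membership in the maximal ideal of `R⁰`: residue zero. [folklore] -/
theorem mem_maximalIdeal_frameRing_iff (x : frameRing L n) :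
    x ∈ maximalIdeal (frameRing L n) ↔ frameResidue L n x = 0 := by
  rw [← ker_frameResidue, RingHom.mem_ker]

/-- **The residue field of `R⁰` is finite** (it is `k_L`). [folklore] -/
instance frameRing_finite_residueField : Finite (ResidueField (frameRing L n)) := by
  haveI := intermediateFieldIntegers.finite_residueField L
  -- `ResidueField R⁰ = R⁰ ⧸ ker (frameResidue) ≃ k_L`
  let e : ResidueField (frameRing L n) →+* ResidueField (intermediateFieldIntegers p L) :=
    Ideal.Quotient.lift (maximalIdeal (frameRing L n)) (frameResidue L n).toRingHom fun x hx =>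
      (mem_maximalIdeal_frameRing_iff L n x).1 hx
  refine Finite.of_injective e fun x y hxy => ?_
  obtain ⟨a, rfl⟩ := Ideal.Quotient.mk_surjective x
  obtain ⟨b, rfl⟩ := Ideal.Quotient.mk_surjective y
  change frameResidue L n a = frameResidue L n b at hxy
  refine (Ideal.Quotient.eq).2 ((mem_maximalIdeal_frameRing_iff L n _).2 ?_)
  rw [map_sub, hxy, sub_self]

/-! ### Regularity -/

/-- **`R⁰` is a regular local ring**: it is the completion of the regular local ring
`𝒪_L[X_{ij}]_{(λ, X)}` (polynomial rings over the discrete valuation ring `𝒪_L` are regular, and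
the completion of a regular local ring is regular local). [cite: Matsumura1987, §19 p. 158] -/
instance frameRing_isRegularLocalRing : IsRegularLocalRing (frameRing L n) := by
  haveI := Literature.AlgebraicGeometry.Resolution.isRegularLocalRing_adicCompletion
    (Localization.AtPrime (frameIdeal L n))
  exact IsRegularLocalRing.of_ringEquiv
    (Literature.AlgebraicGeometry.Resolution.adicCompletionAtMaximalEquiv (frameIdeal L n)).symm

/-- `R⁰` is a domain (a regular local ring is a domain). [cite: Matsumura1987, Thm. 14.3] -/
instance frameRing_isDomain : IsDomain (frameRing L n) :=
  Literature.AlgebraicGeometry.Resolution.isDomain_of_isRegularLocalRing _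

/-- `S = 𝒪_L[X]` is separated for the `𝔪₀`-adic topology (Krull's intersection theorem in the
Noetherian domain `S`). [folklore] -/
instance framePoly_isHausdorff : IsHausdorff (frameIdeal L n) (framePoly L n) := by
  refine isHausdorff_iff.2 fun x hx => ?_
  have hmem : x ∈ ⨅ i : ℕ, frameIdeal L n ^ i := by
    refine Ideal.mem_iInf.2 fun i => ?_
    have h := hx i
    rwa [SModEq.zero, smul_eq_mul, Ideal.mul_top] at h
  rwa [Ideal.iInf_pow_eq_bot_of_isDomain _ (Ideal.IsMaximal.ne_top inferInstance), Ideal.mem_bot] at hmem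

/-- **`S → R⁰` is injective.** [folklore] -/
theorem algebraMap_frameRing_injective :
    Function.Injective (algebraMap (framePoly L n) (frameRing L n)) := fun x y h => by
  rw [AdicCompletion.algebraMap_apply, AdicCompletion.algebraMap_apply, Algebra.algebraMap_self,
    RingHom.id_apply, RingHom.id_apply] at h
  exact AdicCompletion.of_injective (frameIdeal L n) (framePoly L n) h

/-- `𝒪_L → R⁰` is injective. [folklore] -/
theorem algebraMap_integers_frameRing_injective :
    Function.Injective (algebraMap (intermediateFieldIntegers p L) (frameRing L n)) := by
  rw [IsScalarTower.algebraMap_eq (intermediateFieldIntegers p L) (framePoly L n) (frameRing L n)]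
  exact (algebraMap_frameRing_injective L n).comp (MvPolynomial.C_injective _ _)

/-- **`p ≠ 0` in `R⁰`.** [folklore] -/
theorem natCast_ne_zero_frameRing : (p : frameRing L n) ≠ 0 := by
  intro h
  apply intermediateFieldIntegers.natCast_ne_zero L
  apply algebraMap_integers_frameRing_injective L n
  rw [map_natCast, h, map_zero]

/-- `R⁰` has no `p`-torsion. [folklore] -/
theorem frameRing_torsionFree (r : frameRing L n) (h : (p : frameRing L n) * r = 0) : r = 0 :=
  (mul_eq_zero.1 h).resolve_left (natCast_ne_zero_frameRing L n)

/-! ### The frame variables and density of polynomials -/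

/-- The frame variable `X_{ij} ∈ R⁰`. [folklore] -/
def frameVar (ij : Fin n × Fin n) : frameRing L n :=
  algebraMap (framePoly L n) (frameRing L n) (MvPolynomial.X ij)

/-- The frame variables lie in the maximal ideal. [folklore] -/
theorem frameVar_mem_maximalIdeal (ij : Fin n × Fin n) : frameVar L n ij ∈ maximalIdeal (frameRing L n) := by
  rw [mem_maximalIdeal_frameRing_iff, frameVar, frameResidue_algebraMap]
  simp [frameAug]

/-- Elements of the maximal ideal of `𝒪_L` map into the maximal ideal of `R⁰`. [folklore] -/
theorem algebraMap_mem_maximalIdeal_frameRing {a : intermediateFieldIntegers p L}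
    (ha : a ∈ maximalIdeal (intermediateFieldIntegers p L)) :
    algebraMap (intermediateFieldIntegers p L) (frameRing L n) a ∈ maximalIdeal (frameRing L n) := by
  rw [mem_maximalIdeal_frameRing_iff, AlgHom.commutes, IsLocalRing.ResidueField.algebraMap_eq,
    IsLocalRing.residue_eq_zero_iff]
  exact ha

omit [FiniteDimensional ℚ_[p] L] in
/-- The `S`-module structure of `R⁰` is the one through `S → R⁰`. [folklore] -/
theorem smul_eq_algebraMap_mul (r : framePoly L n) (y : frameRing L n) :
    r • y = algebraMap (framePoly L n) (frameRing L n) r * y :=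
  Algebra.smul_def r y

/-- **Levels**: `evalₐ m x = 0 ↔ x ∈ 𝔪ᵐ` (Stacks 05GG (2): `𝔪₀ᵐ R⁰ = ker (R⁰ → S/𝔪₀ᵐ)`).
[cite: StacksProject, Tag 05GG] -/
theorem evalₐ_eq_zero_iff (m : ℕ) (x : frameRing L n) :
    AdicCompletion.evalₐ (frameIdeal L n) m x = 0 ↔ x ∈ maximalIdeal (frameRing L n) ^ m := by
  have eq : frameIdeal L n ^ m • (⊤ : Ideal (framePoly L n)) = frameIdeal L n ^ m := by
    rw [smul_eq_mul, Ideal.mul_top]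
  rw [maximalIdeal_frameRing, ← Ideal.map_pow]
  constructor
  · intro h0
    have h1 : AdicCompletion.eval (frameIdeal L n) (framePoly L n) m x = 0 := by
      rw [← AdicCompletion.factor_evalₐ_eq_eval (frameIdeal L n) x (le_of_eq eq.symm), h0, map_zero]
    have hx : x ∈ (frameIdeal L n ^ m • ⊤ : Submodule (framePoly L n) (frameRing L n)) := by
      rw [AdicCompletion.pow_smul_top_eq_ker_eval (frameIdeal_fg L n)]
      exact h1
    refine Submodule.smul_induction_on hx (fun r hr y _ => ?_) (fun a b ha hb => Ideal.add_mem _ ha hb)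
    rw [smul_eq_algebraMap_mul]
    exact Ideal.mul_mem_right _ _ (Ideal.mem_map_of_mem _ hr)
  · intro hx
    have hle : (frameIdeal L n ^ m).map (algebraMap (framePoly L n) (frameRing L n)) ≤
        RingHom.ker (AdicCompletion.evalₐ (frameIdeal L n) m) := by
      refine Ideal.map_le_iff_le_comap.2 fun s hs => ?_
      rw [Ideal.mem_comap, RingHom.mem_ker, AdicCompletion.algebraMap_apply, Algebra.algebraMap_self,
        RingHom.id_apply, AdicCompletion.evalₐ_of]
      exact Ideal.Quotient.eq_zero_iff_mem.2 hs
    exact hle hx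

/-- Congruence modulo `𝔪ᵐ` is equality at level `m`. [folklore] -/
theorem sub_mem_maximalIdeal_pow_iff (m : ℕ) (x y : frameRing L n) :
    x - y ∈ maximalIdeal (frameRing L n) ^ m ↔
      AdicCompletion.evalₐ (frameIdeal L n) m x = AdicCompletion.evalₐ (frameIdeal L n) m y := by
  rw [← evalₐ_eq_zero_iff, map_sub, sub_eq_zero]

/-- **Density of polynomials**: every element of `R⁰` is congruent modulo `𝔪ᵐ` to (the image of)
a polynomial. [folklore] -/
theorem exists_polynomial_sub_mem_pow (m : ℕ) (r : frameRing L n) :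
    ∃ s : framePoly L n, r - algebraMap (framePoly L n) (frameRing L n) s ∈ maximalIdeal (frameRing L n) ^ m := by
  obtain ⟨s, hs⟩ := Ideal.Quotient.mk_surjective (AdicCompletion.evalₐ (frameIdeal L n) m r)
  refine ⟨s, ?_⟩
  rw [sub_mem_maximalIdeal_pow_iff, ← hs, AdicCompletion.algebraMap_apply, Algebra.algebraMap_self, RingHom.id_apply,
    AdicCompletion.evalₐ_of]

end Literature.NumberTheory.GaloisRepresentations

end
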